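import Summits.HubbardSuperconductivity.HubbardSuperconductivity.Theses.FixedNodeShadow
import Literature.MathematicalPhysics.QuantumLattice.FixedNode

/-!
# Route `FixedNodeShadow`, support `FnSignedPerron` (item stmt-HubbardSuperconductivity-2107)

F2 SIGNED STOQUASTICITY + PERRON. For `A` with real symmetric entries and a nowhere-zero guiding
vector `f`, the fixed-node matrix `F = FN(A, f)` (inlined in the route statement; definitionally
`fixedNodeMatrix A f`) satisfies `Re (F i j) · f i · f j ≤ 0` off the diagonal, and, when the GOOD
graph `{Re (A b c) · f b · f c < 0}` is connected, every ground-state vector of `F` (an eigenvector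
at a lower bound `E` of the quadratic form) is `c • (sgn (f i) · r i)ᵢ` with `r > 0` entrywise.
Both clauses are proved statements of `Literature/MathematicalPhysics/QuantumLattice/FixedNode.lean`
(`fixedNodeMatrix_re_apply_mul_mul_nonpos`, `fixedNodeMatrix_groundState_pos_signed` — the tree's
Perron–Frobenius theorem applied to `diag (sgn f) · F · diag (sgn f)`). ten Haaf et al., PRB 51
(1995) 13039; Becca–Sorella (2017) §10.4; Lieb–Wu, Physica A 321 (2003) §2.
-/

-- the mandated namespace `Summit.<Summit>.<Problem>.Theorems` repeats `HubbardSuperconductivity`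
-- (single-problem summit, D-0017), which the `dupNamespace` linter flags on every declaration
set_option linter.dupNamespace false

namespace Summit.HubbardSuperconductivity.HubbardSuperconductivity.Theorems.FixedNodeShadow

open Matrix Literature.MathematicalPhysics.QuantumLattice

/-- **`FnSignedPerron`** (route `FixedNodeShadow`, item stmt-HubbardSuperconductivity-2107): the
fixed-node matrix is stoquastic in the signed basis `sgn (f i) • |i⟩`, and on a connected good
graph its ground state has exactly the sign structure of the trial vector.
[cite: BeccaSorella2017, §10.4 after eq. (10.38)] -/
theorem fnSignedPerron_proof :
    Summit.HubbardSuperconductivity.HubbardSuperconductivity.Theses.FixedNodeShadow.FnSignedPerron := by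
  intro n _ _ A f hsymm hreal hf hconn F hF
  have hF' : F = fixedNodeMatrix A f := hF
  subst hF'
  refine ⟨fun i j hij => fixedNodeMatrix_re_apply_mul_mul_nonpos A f hij, ?_⟩
  intro E hE v hv hv0
  exact fixedNodeMatrix_groundState_pos_signed hsymm hreal hf hconn hE hv hv0

end Summit.HubbardSuperconductivity.HubbardSuperconductivity.Theorems.FixedNodeShadow
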